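import Mathlib
import HarnessLib
import Summits.AtomisticToContinuum.FouriersLaw.Theses.JunctionLocality
import Summits.AtomisticToContinuum.FouriersLaw.Theorems.JunctionLocalityConductanceLowerBoundOddFieldFrame

/-!
# The floor is the odd-field ceiling (crux stmt-AtomisticToContinuum-11749, line ForecastSensitivitySketch)

Helper file (`--supports stmt-AtomisticToContinuum-11749`, lead c3), companion of `…OddFieldFrame`:

* `response_le_half_gamma` — `D_L ≤ (L−1)·γ/2` for every `L ≥ 2` along the crux's data (weak-NESS uniqueness, a steady
  family, its response coefficients at `T > 0`): the contact bound `E_far ≤ T/(4γ²)` read through `response_eq_dirichlet`;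
* `floor_iff_oddFieldCeiling` — the transmission-gradient floor (= the crux, `conductanceLowerBound_iff_floor`) is
  EQUIVALENT to the ODD-FIELD CEILING: for the reflection-odd field `a = (g − g∘R)/2` of every left forward field `g`,
  `∫ (∂_{p_{L−1}} a)² dμ_T ≤ T/(4γ²) − c/(L−1)` — the antisymmetric (genuinely non-equilibrium) response must keep its contact
  Dirichlet energy `≳ 1/L` BELOW the insulator value `T/(4γ²)`; this is the form in which the two-sided (inf) variational
  principle for `⟨w, (−L_{T,T})⁻¹ w⟩`, `w = k_0 − k_{L−1}`, gives upper bounds (crux NOTES T4 (iii), kernel-checked).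

No definitions, no named facts, no sorry.
-/

noncomputable section

open MeasureTheory Filter Topology
open scoped ContDiff
open Literature.MathematicalPhysics.KineticTheory.HeatConduction
open Summit.AtomisticToContinuum.FouriersLaw.Theorems.SuperadditiveResistance.DeviceLiouville (kin)
open Summit.AtomisticToContinuum.FouriersLaw.Cruxes.SuperadditiveResistance.FloatingProbeBypassLaplacian
  (stub_plainForwardField)

namespace Summit.AtomisticToContinuum.FouriersLaw.Cruxes.ConductanceLowerBound.ForecastSensitivity

variable {ω₂ lam β γ T : ℝ}

/-- **`D_L ≤ (L−1)·γ/2`** along the crux's data (weak-NESS uniqueness, a steady family, its response coefficients at `T > 0`),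
for every `L ≥ 2`: the response coefficient never exceeds the two-contact series value. [folklore] -/
theorem response_le_half_gamma
    {μ : (N : ℕ) → ℝ → ℝ → Measure (PhaseSpace N)} {D : ℕ → ℝ}
    (hω : 0 < ω₂) (hl : 0 < lam) (hβ : 0 < β) (hγ : 0 < γ) (hT : 0 < T)
    (hU : ∀ (N : ℕ) (T_L T_R : ℝ), 0 < T_L → 0 < T_R → ∀ ρ ρ' : Measure (PhaseSpace N),
        (pinnedChain ω₂ lam β γ).IsSteadyState N T_L T_R ρ →
        (pinnedChain ω₂ lam β γ).IsSteadyState N T_L T_R ρ' → ρ = ρ')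
    (hμ : ∀ (N : ℕ) (T_L T_R : ℝ), 0 < T_L → 0 < T_R →
        (pinnedChain ω₂ lam β γ).IsSteadyState N T_L T_R (μ N T_L T_R))
    (hD : ∀ N : ℕ, Tendsto (fun δ : ℝ =>
        (pinnedChain ω₂ lam β γ).totalCurrent (μ N (T + δ / 2) (T - δ / 2)) / δ) (𝓝[≠] 0) (𝓝 (D N)))
    {L : ℕ} (hL2 : 2 ≤ L) : D L ≤ ((L : ℝ) - 1) * (γ / 2) := by
  obtain ⟨g, hgC, hgL2, hg0, hgeq⟩ := stub_plainForwardField ω₂ lam β γ T hω hl hβ hγ hT L hL2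
  rw [response_eq_dirichlet hω hl hβ hγ hT hU hμ hD hL2 hgC hgL2 hg0 hgeq]
  have hE := farGradient_sq_le hω hl hβ hγ hT hL2 hgC hgL2 hg0 hgeq
  have hLnn : (0 : ℝ) ≤ (L : ℝ) - 1 := by
    have : (2 : ℝ) ≤ L := by exact_mod_cast hL2
    linarith
  have h2 : 0 ≤ 2 * γ ^ 3 / T := by positivity
  calc ((L : ℝ) - 1) * (2 * γ ^ 3 / T *
        ∫ x, (partialP (⟨L - 1, by omega⟩ : Fin L) g x) ^ 2 ∂((pinnedChain ω₂ lam β γ).gibbsMeasure L T))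
      ≤ ((L : ℝ) - 1) * (2 * γ ^ 3 / T * (T / (4 * γ ^ 2))) :=
        mul_le_mul_of_nonneg_left (mul_le_mul_of_nonneg_left hE h2) hLnn
    _ = ((L : ℝ) - 1) * (γ / 2) := by
        have hT0 : T ≠ 0 := hT.ne'
        have hγ0 : γ ≠ 0 := hγ.ne'
        field_simp
        ring

/-! ## §3 The floor is the odd-field ceiling -/

/-- **FLOOR ⟺ ODD-FIELD CEILING.**  The transmission-gradient floor (= the crux, `conductanceLowerBound_iff_floor`) holds iff
for all parameters `> 0`, `T > 0` there are `c > 0`, `L₁` with: for every `L ≥ L₁` (`L ≥ 2`) and every classical mean-zero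
`C² ∩ L²(μ_T)` left forward field `g`, the reflection-odd field `a = (g − g∘R)/2` has
`∫ (∂_{p_{L−1}} a)² dμ_T ≤ T/(4γ²) − c/(L−1)`. [folklore] -/
theorem floor_iff_oddFieldCeiling : (∀ (ω₂ lam β γ T : ℝ), 0 < ω₂ → 0 < lam → 0 < β → 0 < γ → 0 < T → ∃ c : ℝ, 0 < c ∧ ∃ L₁ : ℕ, ∀ (L : ℕ) (hL : 2 ≤ L), L₁ ≤ L → ∀ g : PhaseSpace L → ℝ, ContDiff ℝ 2 g → MemLp g 2 ((pinnedChain ω₂ lam β γ).gibbsMeasure L T) → ∫ x, g x ∂((pinnedChain ω₂ lam β γ).gibbsMeasure L T) = 0 → (∀ x, (pinnedChain ω₂ lam β γ).generator L T T g x = -(kin L 0 x - T)) → c ≤ ((L : ℝ) - 1) * ∫ x, (partialP (⟨L - 1, by omega⟩ : Fin L) g x) ^ 2 ∂((pinnedChain ω₂ lam β γ).gibbsMeasure L T)) ↔ (∀ (ω₂ lam β γ T : ℝ), 0 < ω₂ → 0 < lam → 0 < β → 0 < γ → 0 < T → ∃ c : ℝ, 0 < c ∧ ∃ L₁ : ℕ,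 ∀ (L : ℕ) (hL : 2 ≤ L), L₁ ≤ L → ∀ g : PhaseSpace L → ℝ, ContDiff ℝ 2 g → MemLp g 2 ((pinnedChain ω₂ lam β γ).gibbsMeasure L T) → ∫ x, g x ∂((pinnedChain ω₂ lam β γ).gibbsMeasure L T) = 0 → (∀ x, (pinnedChain ω₂ lam β γ).generator L T T g x = -(kin L 0 x - T)) → ∫ x, (partialP (⟨L - 1, by omega⟩ : Fin L) (fun y => (g y - g (siteReflection L y)) / 2) x) ^ 2 ∂((pinnedChain ω₂ lam β γ).gibbsMeasure L T) ≤ T / (4 * γ ^ 2) - c / ((L : ℝ) - 1)) := by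
  constructor
  · intro h ω₂ lam β γ T hω hl hβ hγ hT
    obtain ⟨c, hc, L₁, hfl⟩ := h ω₂ lam β γ T hω hl hβ hγ hT
    refine ⟨c, hc, L₁, fun L hL hL1 g hgC hgL2 hg0 hgeq => ?_⟩
    have hLpos : (0 : ℝ) < (L : ℝ) - 1 := by
      have : (2 : ℝ) ≤ L := by exact_mod_cast hL
      linarith
    rw [oddField_farGradient_sq_eq' hω hl hβ hγ hT hL hgC hgL2 hg0 hgeq]
    have h1 := hfl L hL hL1 g hgC hgL2 hg0 hgeq
    have h2 : c / ((L : ℝ) - 1) ≤ ∫ x, (partialP (⟨L - 1, by omega⟩ : Fin L) g x) ^ 2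
        ∂((pinnedChain ω₂ lam β γ).gibbsMeasure L T) := by
      rw [div_le_iff₀ hLpos]; linarith
    linarith
  · intro h ω₂ lam β γ T hω hl hβ hγ hT
    obtain ⟨c, hc, L₁, hce⟩ := h ω₂ lam β γ T hω hl hβ hγ hT
    refine ⟨c, hc, L₁, fun L hL hL1 g hgC hgL2 hg0 hgeq => ?_⟩
    have hLpos : (0 : ℝ) < (L : ℝ) - 1 := by
      have : (2 : ℝ) ≤ L := by exact_mod_cast hL
      linarith
    have h1 := hce L hL hL1 g hgC hgL2 hg0 hgeq
    rw [oddField_farGradient_sq_eq' hω hl hβ hγ hT hL hgC hgL2 hg0 hgeq] at h1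
    have h2 : c / ((L : ℝ) - 1) ≤ ∫ x, (partialP (⟨L - 1, by omega⟩ : Fin L) g x) ^ 2
        ∂((pinnedChain ω₂ lam β γ).gibbsMeasure L T) := by linarith
    rwa [div_le_iff₀ hLpos, mul_comm] at h2

end Summit.AtomisticToContinuum.FouriersLaw.Cruxes.ConductanceLowerBound.ForecastSensitivity

end
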